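import Summits.CriticalPhenomena.PercolationContinuityZ3.Theorems.PercNearOneGluingNoHeavyLowerTailKnQuestion8CoefficientwiseZoneFlip
import HarnessLib

/-!
# The lobe flip: every crossing wall colouring is sent to a concordant one by recolouring the edges at the lobe of `w`

Support file (`--supports stmt-CriticalPhenomena-4575`, closed), prover `prim-lf-2` (gen 44).  No definitions, no notations, no named facts,
no sorries; standard axioms.  Memo `prim-lf-2/CW-LOBEFLIP-gen44.md` §1.

Setting (prim-lf-2's `Coefficientwise` files): finite multigraph `ends : ι → Sym2 V`, colourings `s : Finset ι` (red; `sᶜ` blue),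
`K = C_x(s) = openCluster (ends '' s) x` the red and `L = C_x(sᶜ)` the blue cluster of the root `x`; the BLUE ISLAND is `L ∖ K`.
No edge joins `K ∖ L` to `L ∖ K`, every edge from `K ∩ L` to the island is blue and every edge from the island to the outside of `K ∪ L` is red.
A LOBE is a vertex set `T ⊆ L ∖ K` met by no edge whose other end lies on the island outside `T` (`hT`, `hTc` below) — e.g. a connected
component of the graph induced on the island, in particular the component `T₀(w)` of a blue-only point `w` (`lobe_subset_island`,
`lobe_closed`).  THE LOBE FLIP recolours every edge meeting `T`: `s ↦ s ∆ M`, `M = {i | ∃ v ∈ T, v ∈ ends i}`.  This file proves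
* `Coefficientwise.lobeFlip_eq` — `C_x(s ∆ M) = K ∪ T` (the old red cluster survives and swallows exactly the lobe);
* `Coefficientwise.lobeFlip_compl_subset` — `C_x((s ∆ M)ᶜ) ⊆ L` and `C_x((s ∆ M)ᶜ) ∩ T = ∅` (the new blue cluster is the part of the old one
  that is blue-reachable without touching the lobe);
* `Coefficientwise.lobeFlip_wall` — every two-sided disconnection `{z ∉ C_x(s)} ∩ {z ∉ C_x(sᶜ)}` (`z` in any wall set) is preserved;
* `Coefficientwise.lobeFlip_crossing` — if `u ∈ K ∖ L` and `w ∈ T` then after the flip BOTH `u` and `w` are red-only: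
  the lobe flip at `T₀(w)` maps every CROSSING wall colouring (`σ_u = +1`, `σ_w = −1`) of the coefficientwise point row
  `P(G;x,Z;u,w) = Σ_wall σ_uσ_w` to a CONCORDANT one (`σ_u = σ_w = +1`) — `Coefficientwise.lobeFlip_cross_to_conc`.
The whole-island case `T = L ∖ K` is prim-cplus-coupling's blue-island flip (…CoefficientwiseIslandFlip, THEOREM P); the lobe version is the
always-admissible move of the star-flip matchings of memo §2 (CONJECTURE ZSF: an injection crossings ↪ concordants by vertex-star flips exists
for every instance — verified for all graphs on ≤ 7 vertices with ≤ 12 edges; the lobe flip alone is not injective).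
[cite: KozmaNitzan2024, Questions 8–9 (§5.5 p. 36) (context: the Question-8 pocket covariance programme)]
-/

namespace Summit.CriticalPhenomena.PercolationContinuityZ3.Theorems

open Finset Literature.Probability.Percolation

namespace Coefficientwise

variable {ι V : Type*} [Fintype ι] [DecidableEq ι]
variable (ends : ι → Sym2 V) (x : V)

/-- Red edges at the old red cluster do not meet the lobe, so the old red cluster survives: `C_x(s) ⊆ C_x(s ∆ M)`. [this work] -/
theorem lobeFlip_red_subset (s M : Finset ι) (T : Set V)
    (hT : ∀ v ∈ T, v ∈ openCluster (ends '' (↑(sᶜ) : Set ι)) x ∧ v ∉ openCluster (ends '' (↑s : Set ι)) x)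
    (hM : ∀ i, i ∈ M ↔ ∃ v, v ∈ T ∧ v ∈ ends i) :
    openCluster (ends '' (↑s : Set ι)) x ⊆ openCluster (ends '' (↑(symmDiff s M) : Set ι)) x := by
  set K : Set V := openCluster (ends '' (↑s : Set ι)) x with hK
  have h : ∀ u ∈ K, ∀ w, (openGraph (ends '' (↑s : Set ι))).Adj u w →
      (openGraph (ends '' (↑(symmDiff s M) : Set ι))).Adj u w ∧ w ∈ K := by
    intro u hu w hadj
    have hadj0 := hadj
    rw [openGraph_image_adj] at hadj
    obtain ⟨⟨i, his, hi⟩, hne⟩ := hadj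
    have hwK : w ∈ K := SimpleGraph.Reachable.trans hu hadj0.reachable
    have hiM : i ∉ M := by
      intro hiM
      obtain ⟨v, hvT, hvi⟩ := (hM i).mp hiM
      rw [hi, Sym2.mem_iff] at hvi
      rcases hvi with rfl | rfl
      · exact (hT _ hvT).2 hu
      · exact (hT _ hvT).2 hwK
    refine ⟨?_, hwK⟩
    rw [openGraph_image_adj]
    exact ⟨⟨i, Finset.mem_symmDiff.mpr (Or.inl ⟨his, hiM⟩), hi⟩, hne⟩
  intro y hy
  obtain ⟨p⟩ := hy
  exact ((reachable_transfer K h p) (mem_openCluster_self _ x)).1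

/-- The lobe is swallowed: `T ⊆ C_x(s ∆ M)`.  Along a blue walk from `x` to a lobe vertex carry the invariant 'a vertex of `K ∪ T` is in the
new red cluster': a blue edge entering `T` comes from `K` (the island outside `T` is not adjacent to `T`) and is flipped to red. [this work] -/
theorem lobeFlip_lobe_subset (s M : Finset ι) (T : Set V)
    (hT : ∀ v ∈ T, v ∈ openCluster (ends '' (↑(sᶜ) : Set ι)) x ∧ v ∉ openCluster (ends '' (↑s : Set ι)) x)
    (hTc : ∀ i, ∀ v ∈ T, v ∈ ends i → ∀ v' ∈ ends i,
      v' ∈ openCluster (ends '' (↑(sᶜ) : Set ι)) x → v' ∉ openCluster (ends '' (↑s : Set ι)) x → v' ∈ T)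
    (hM : ∀ i, i ∈ M ↔ ∃ v, v ∈ T ∧ v ∈ ends i) :
    T ⊆ openCluster (ends '' (↑(symmDiff s M) : Set ι)) x := by
  set K : Set V := openCluster (ends '' (↑s : Set ι)) x with hK
  set L : Set V := openCluster (ends '' (↑(sᶜ) : Set ι)) x with hL
  set K' : Set V := openCluster (ends '' (↑(symmDiff s M) : Set ι)) x with hK'
  have hKK' : K ⊆ K' := lobeFlip_red_subset ends x s M T hT hM
  -- invariant set: vertices of `L` such that (membership in `K ∪ T` ⇒ membership in `K'`)
  set S : Set V := {v | v ∈ L ∧ ((v ∈ K ∨ v ∈ T) → v ∈ K')} with hS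
  have h : ∀ u ∈ S, ∀ w, (openGraph (ends '' (↑(sᶜ) : Set ι))).Adj u w → (⊤ : SimpleGraph V).Adj u w ∧ w ∈ S := by
    intro u hu w hadj
    have hadj0 := hadj
    rw [openGraph_image_adj] at hadj
    obtain ⟨⟨i, hisc, hi⟩, hne⟩ := hadj
    have hwL : w ∈ L := SimpleGraph.Reachable.trans hu.1 hadj0.reachable
    refine ⟨(SimpleGraph.top_adj u w).mpr hne, hwL, ?_⟩
    intro hw
    rcases hw with hwK | hwT
    · exact hKK' hwK
    · -- the blue edge `i = {u, w}` meets `T` at `w`: it is flipped to red; and `u ∈ K ∪ T`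
      have hui : u ∈ ends i := by rw [hi]; exact Sym2.mem_mk_left u w
      have hwi : w ∈ ends i := by rw [hi]; exact Sym2.mem_mk_right u w
      have hiM : i ∈ M := (hM i).mpr ⟨w, hwT, hwi⟩
      have his : i ∉ s := Finset.mem_compl.mp hisc
      have hiP : i ∈ symmDiff s M := Finset.mem_symmDiff.mpr (Or.inr ⟨hiM, his⟩)
      have huKT : u ∈ K ∨ u ∈ T := by
        by_cases huK : u ∈ K
        · exact Or.inl huK
        · exact Or.inr (hTc i w hwT hwi u hui hu.1 huK)
      have huK' : u ∈ K' := hu.2 huKT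
      have hadj' : (openGraph (ends '' (↑(symmDiff s M) : Set ι))).Adj u w := by
        rw [openGraph_image_adj]; exact ⟨⟨i, hiP, hi⟩, hne⟩
      exact SimpleGraph.Reachable.trans huK' hadj'.reachable
  intro t ht
  have htL : t ∈ L := (hT t ht).1
  obtain ⟨p⟩ := htL
  have hx : x ∈ S := ⟨mem_openCluster_self _ x, fun _ => mem_openCluster_self _ x⟩
  exact ((reachable_transfer S h p) hx).2.2 (Or.inr ht)

/-- The new red cluster does not leave `K ∪ T`: `C_x(s ∆ M) ⊆ C_x(s) ∪ T`. [this work] -/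
theorem lobeFlip_subset (s M : Finset ι) (T : Set V)
    (hT : ∀ v ∈ T, v ∈ openCluster (ends '' (↑(sᶜ) : Set ι)) x ∧ v ∉ openCluster (ends '' (↑s : Set ι)) x)
    (hTc : ∀ i, ∀ v ∈ T, v ∈ ends i → ∀ v' ∈ ends i,
      v' ∈ openCluster (ends '' (↑(sᶜ) : Set ι)) x → v' ∉ openCluster (ends '' (↑s : Set ι)) x → v' ∈ T)
    (hM : ∀ i, i ∈ M ↔ ∃ v, v ∈ T ∧ v ∈ ends i) :
    openCluster (ends '' (↑(symmDiff s M) : Set ι)) x ⊆ openCluster (ends '' (↑s : Set ι)) x ∪ T := by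
  set K : Set V := openCluster (ends '' (↑s : Set ι)) x with hK
  set L : Set V := openCluster (ends '' (↑(sᶜ) : Set ι)) x with hL
  have h : ∀ u ∈ (K ∪ T), ∀ w, (openGraph (ends '' (↑(symmDiff s M) : Set ι))).Adj u w →
      (⊤ : SimpleGraph V).Adj u w ∧ w ∈ (K ∪ T) := by
    intro u hu w hadj
    rw [openGraph_image_adj] at hadj
    obtain ⟨⟨i, hiP, hi⟩, hne⟩ := hadj
    refine ⟨(SimpleGraph.top_adj u w).mpr hne, ?_⟩
    have hui : u ∈ ends i := by rw [hi]; exact Sym2.mem_mk_left u w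
    have hwi : w ∈ ends i := by rw [hi]; exact Sym2.mem_mk_right u w
    rcases Finset.mem_symmDiff.mp hiP with ⟨his, hiM⟩ | ⟨hiM, his⟩
    · -- unflipped red edge: it does not meet `T`, so `u ∈ K` and then `w ∈ K`
      have huK : u ∈ K := by
        rcases hu with huK | huT
        · exact huK
        · exact absurd ((hM i).mpr ⟨u, huT, hui⟩) hiM
      exact Or.inl (mem_openCluster_of_mem_ends ends s x his huK hui hwi)
    · -- flipped edge: blue, meeting `T` at `v ∈ {u, w}`; the other end is in `L`, hence in `K` or on the island next to `T`, hence in `T`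
      obtain ⟨v, hvT, hvi⟩ := (hM i).mp hiM
      have hisc : i ∈ sᶜ := Finset.mem_compl.mpr his
      have hvL : v ∈ L := (hT v hvT).1
      rw [hi, Sym2.mem_iff] at hvi
      rcases hvi with hvu | hvw
      · -- `v = u ∈ T`; `w ∈ L`
        rw [hvu] at hvT hvL
        have hwL : w ∈ L := mem_openCluster_of_mem_ends ends sᶜ x hisc hvL hui hwi
        by_cases hwK : w ∈ K
        · exact Or.inl hwK
        · exact Or.inr (hTc i u hvT hui w hwi hwL hwK)
      · rw [hvw] at hvT
        exact Or.inr hvT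
  intro y hy
  obtain ⟨p⟩ := hy
  have hx : x ∈ K ∪ T := Or.inl (mem_openCluster_self _ x)
  exact ((reachable_transfer (K ∪ T) h p) hx).2

/-- **The lobe flip formula for the red cluster**: `C_x(s ∆ M) = C_x(s) ∪ T`. [this work] -/
theorem lobeFlip_eq (s M : Finset ι) (T : Set V)
    (hT : ∀ v ∈ T, v ∈ openCluster (ends '' (↑(sᶜ) : Set ι)) x ∧ v ∉ openCluster (ends '' (↑s : Set ι)) x)
    (hTc : ∀ i, ∀ v ∈ T, v ∈ ends i → ∀ v' ∈ ends i,
      v' ∈ openCluster (ends '' (↑(sᶜ) : Set ι)) x → v' ∉ openCluster (ends '' (↑s : Set ι)) x → v' ∈ T)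
    (hM : ∀ i, i ∈ M ↔ ∃ v, v ∈ T ∧ v ∈ ends i) :
    openCluster (ends '' (↑(symmDiff s M) : Set ι)) x = openCluster (ends '' (↑s : Set ι)) x ∪ T :=
  Set.Subset.antisymm (lobeFlip_subset ends x s M T hT hTc hM)
    (Set.union_subset (lobeFlip_red_subset ends x s M T hT hM) (lobeFlip_lobe_subset ends x s M T hT hTc hM))

/-- **The new blue cluster stays inside the old one and off the lobe**: `C_x((s ∆ M)ᶜ) ⊆ C_x(sᶜ) ∖ T`.  (A new-blue edge at a vertex of
`L ∖ T` is an unflipped blue edge — other end in `L`, and not in `T` since the edge misses `T` — or a flipped red edge meeting `T` at its other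
end; the latter is impossible: its near end would be in `K`, making the `T`-end red-reachable, or on the island next to `T`, hence in `T`.)
[this work] -/
theorem lobeFlip_compl_subset (s M : Finset ι) (T : Set V)
    (hT : ∀ v ∈ T, v ∈ openCluster (ends '' (↑(sᶜ) : Set ι)) x ∧ v ∉ openCluster (ends '' (↑s : Set ι)) x)
    (hTc : ∀ i, ∀ v ∈ T, v ∈ ends i → ∀ v' ∈ ends i,
      v' ∈ openCluster (ends '' (↑(sᶜ) : Set ι)) x → v' ∉ openCluster (ends '' (↑s : Set ι)) x → v' ∈ T)
    (hM : ∀ i, i ∈ M ↔ ∃ v, v ∈ T ∧ v ∈ ends i) :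
    openCluster (ends '' (↑((symmDiff s M)ᶜ) : Set ι)) x ⊆ openCluster (ends '' (↑(sᶜ) : Set ι)) x \ T := by
  set K : Set V := openCluster (ends '' (↑s : Set ι)) x with hK
  set L : Set V := openCluster (ends '' (↑(sᶜ) : Set ι)) x with hL
  have h : ∀ u ∈ (L \ T), ∀ w, (openGraph (ends '' (↑((symmDiff s M)ᶜ) : Set ι))).Adj u w →
      (⊤ : SimpleGraph V).Adj u w ∧ w ∈ (L \ T) := by
    intro u hu w hadj
    rw [openGraph_image_adj] at hadj
    obtain ⟨⟨i, hiPc, hi⟩, hne⟩ := hadj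
    refine ⟨(SimpleGraph.top_adj u w).mpr hne, ?_⟩
    have hui : u ∈ ends i := by rw [hi]; exact Sym2.mem_mk_left u w
    have hwi : w ∈ ends i := by rw [hi]; exact Sym2.mem_mk_right u w
    have hiPc' : i ∉ symmDiff s M := Finset.mem_compl.mp hiPc
    rw [Finset.mem_symmDiff] at hiPc'
    by_cases his : i ∈ s
    · -- red and in `M`: `i` meets `T` at `v`; `v ≠ u` side: `v = w`.  Then `u ∈ K` would give `w ∈ K`; else `u` on the island next to `T`.
      have hiM : i ∈ M := by by_contra hiM; exact hiPc' (Or.inl ⟨his, hiM⟩)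
      obtain ⟨v, hvT, hvi⟩ := (hM i).mp hiM
      exfalso
      rw [hi, Sym2.mem_iff] at hvi
      have hwT : w ∈ T := by
        rcases hvi with rfl | rfl
        · exact absurd hvT hu.2
        · exact hvT
      by_cases huK : u ∈ K
      · exact (hT w hwT).2 (mem_openCluster_of_mem_ends ends s x his huK hui hwi)
      · exact hu.2 (hTc i w hwT hwi u hui hu.1 huK)
    · -- blue and not in `M`
      have hiM : i ∉ M := by intro hiM; exact hiPc' (Or.inr ⟨hiM, his⟩)
      have hisc : i ∈ sᶜ := Finset.mem_compl.mpr his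
      have hwL : w ∈ L := mem_openCluster_of_mem_ends ends sᶜ x hisc hu.1 hui hwi
      have hwT : w ∉ T := fun hwT => hiM ((hM i).mpr ⟨w, hwT, hwi⟩)
      exact ⟨hwL, hwT⟩
  intro y hy
  obtain ⟨p⟩ := hy
  have hxT : x ∉ T := fun hxT => (hT x hxT).2 (mem_openCluster_self _ x)
  have hx : x ∈ L \ T := ⟨mem_openCluster_self _ x, hxT⟩
  exact ((reachable_transfer (L \ T) h p) hx).2

/-- **The lobe flip preserves every two-sided disconnection** `{z ∉ C_x(s)} ∩ {z ∉ C_x(sᶜ)}` (the wall event of a wall set `Z ∋ z`). [this work] -/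
theorem lobeFlip_wall (s M : Finset ι) (T : Set V)
    (hT : ∀ v ∈ T, v ∈ openCluster (ends '' (↑(sᶜ) : Set ι)) x ∧ v ∉ openCluster (ends '' (↑s : Set ι)) x)
    (hTc : ∀ i, ∀ v ∈ T, v ∈ ends i → ∀ v' ∈ ends i,
      v' ∈ openCluster (ends '' (↑(sᶜ) : Set ι)) x → v' ∉ openCluster (ends '' (↑s : Set ι)) x → v' ∈ T)
    (hM : ∀ i, i ∈ M ↔ ∃ v, v ∈ T ∧ v ∈ ends i) {z : V}
    (h1 : z ∉ openCluster (ends '' (↑s : Set ι)) x) (h2 : z ∉ openCluster (ends '' (↑(sᶜ) : Set ι)) x) :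
    z ∉ openCluster (ends '' (↑(symmDiff s M) : Set ι)) x ∧ z ∉ openCluster (ends '' (↑((symmDiff s M)ᶜ) : Set ι)) x := by
  constructor
  · intro hz
    rcases lobeFlip_subset ends x s M T hT hTc hM hz with h | h
    · exact h1 h
    · exact h2 (hT z h).1
  · intro hz
    exact h2 (lobeFlip_compl_subset ends x s M T hT hTc hM hz).1

/-- **Crossing ↦ concordant.**  If `u` is red-only (`u ∈ C_x(s) ∖ C_x(sᶜ)`) and `w ∈ T`, then after the lobe flip both `u` and `w` are red-only.
[this work] -/
theorem lobeFlip_crossing (s M : Finset ι) (T : Set V)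
    (hT : ∀ v ∈ T, v ∈ openCluster (ends '' (↑(sᶜ) : Set ι)) x ∧ v ∉ openCluster (ends '' (↑s : Set ι)) x)
    (hTc : ∀ i, ∀ v ∈ T, v ∈ ends i → ∀ v' ∈ ends i,
      v' ∈ openCluster (ends '' (↑(sᶜ) : Set ι)) x → v' ∉ openCluster (ends '' (↑s : Set ι)) x → v' ∈ T)
    (hM : ∀ i, i ∈ M ↔ ∃ v, v ∈ T ∧ v ∈ ends i) {u w : V}
    (huK : u ∈ openCluster (ends '' (↑s : Set ι)) x) (huL : u ∉ openCluster (ends '' (↑(sᶜ) : Set ι)) x) (hw : w ∈ T) :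
    (u ∈ openCluster (ends '' (↑(symmDiff s M) : Set ι)) x ∧ u ∉ openCluster (ends '' (↑((symmDiff s M)ᶜ) : Set ι)) x) ∧
    (w ∈ openCluster (ends '' (↑(symmDiff s M) : Set ι)) x ∧ w ∉ openCluster (ends '' (↑((symmDiff s M)ᶜ) : Set ι)) x) := by
  refine ⟨⟨lobeFlip_red_subset ends x s M T hT hM huK, fun h => huL (lobeFlip_compl_subset ends x s M T hT hTc hM h).1⟩,
    ⟨lobeFlip_lobe_subset ends x s M T hT hTc hM hw, fun h => (lobeFlip_compl_subset ends x s M T hT hTc hM h).2 hw⟩⟩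

/-- **The canonical lobe `T₀(w)`** — the component of `w` in the graph induced on the island, i.e. `openCluster (ends '' I₀) w` for
`I₀ = {i | every end of i is on the island}` — lies on the island when `w` does. [this work] -/
theorem lobe_subset_island (s I₀ : Finset ι) (w : V)
    (hI₀ : ∀ i, i ∈ I₀ ↔ ∀ y ∈ ends i, y ∈ openCluster (ends '' (↑(sᶜ) : Set ι)) x ∧ y ∉ openCluster (ends '' (↑s : Set ι)) x)
    (hwL : w ∈ openCluster (ends '' (↑(sᶜ) : Set ι)) x) (hwK : w ∉ openCluster (ends '' (↑s : Set ι)) x) :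
    ∀ v ∈ openCluster (ends '' (↑I₀ : Set ι)) w,
      v ∈ openCluster (ends '' (↑(sᶜ) : Set ι)) x ∧ v ∉ openCluster (ends '' (↑s : Set ι)) x := by
  set K : Set V := openCluster (ends '' (↑s : Set ι)) x with hK
  set L : Set V := openCluster (ends '' (↑(sᶜ) : Set ι)) x with hL
  set Isl : Set V := {v | v ∈ L ∧ v ∉ K} with hIsl
  have h : ∀ a ∈ Isl, ∀ b, (openGraph (ends '' (↑I₀ : Set ι))).Adj a b → (⊤ : SimpleGraph V).Adj a b ∧ b ∈ Isl := by
    intro a _ b hadj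
    rw [openGraph_image_adj] at hadj
    obtain ⟨⟨i, hiI, hi⟩, hne⟩ := hadj
    have hbi : b ∈ ends i := by rw [hi]; exact Sym2.mem_mk_right a b
    exact ⟨(SimpleGraph.top_adj a b).mpr hne, (hI₀ i).mp hiI b hbi⟩
  intro v hv
  obtain ⟨p⟩ := hv
  exact ((reachable_transfer Isl h p) ⟨hwL, hwK⟩).2

/-- **The canonical lobe is closed**: an edge at `T₀(w)` whose other end is on the island has that end in `T₀(w)` (the edge has both ends on the
island, so it is an `I₀`-edge). [this work] -/
theorem lobe_closed (s I₀ : Finset ι) (w : V)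
    (hI₀ : ∀ i, i ∈ I₀ ↔ ∀ y ∈ ends i, y ∈ openCluster (ends '' (↑(sᶜ) : Set ι)) x ∧ y ∉ openCluster (ends '' (↑s : Set ι)) x)
    (hwL : w ∈ openCluster (ends '' (↑(sᶜ) : Set ι)) x) (hwK : w ∉ openCluster (ends '' (↑s : Set ι)) x) :
    ∀ i, ∀ v ∈ openCluster (ends '' (↑I₀ : Set ι)) w, v ∈ ends i → ∀ v' ∈ ends i,
      v' ∈ openCluster (ends '' (↑(sᶜ) : Set ι)) x → v' ∉ openCluster (ends '' (↑s : Set ι)) x →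
      v' ∈ openCluster (ends '' (↑I₀ : Set ι)) w := by
  intro i v hv hvi v' hv'i hv'L hv'K
  by_cases hvv' : v = v'
  · subst hvv'; exact hv
  · have hvIsl := lobe_subset_island ends x s I₀ w hI₀ hwL hwK v hv
    have he : ends i = s(v, v') := (Sym2.mem_and_mem_iff hvv').mp ⟨hvi, hv'i⟩
    have hiI : i ∈ I₀ := by
      rw [hI₀ i]
      intro y hy
      rw [he, Sym2.mem_iff] at hy
      rcases hy with rfl | rfl
      · exact hvIsl
      · exact ⟨hv'L, hv'K⟩
    have hadj : (openGraph (ends '' (↑I₀ : Set ι))).Adj v v' := by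
      rw [openGraph_image_adj]; exact ⟨⟨i, hiI, he⟩, hvv'⟩
    exact SimpleGraph.Reachable.trans hv hadj.reachable

/-- **THE LOBE FLIP SENDS CROSSINGS TO CONCORDANTS.**  For a finite multigraph `ends : ι → Sym2 V`, a root `x`, a wall set `Z`, points `u, w`
and a colouring `s` on the wall (`Z ∩ C_x(s) = ∅ = Z ∩ C_x(sᶜ)`) which is a CROSSING (`u ∈ C_x(s) ∖ C_x(sᶜ)`, `w ∈ C_x(sᶜ) ∖ C_x(s)`): with
`I₀` the edges inside the blue island, `T₀ = openCluster (ends '' I₀) w` the lobe of `w` and `M` the edges meeting `T₀`, the colouring `s ∆ M`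
is again on the wall and is CONCORDANT (`u, w ∈ C_x(s ∆ M) ∖ C_x((s ∆ M)ᶜ)`), with `C_x(s ∆ M) = C_x(s) ∪ T₀`.  (This is the always-admissible
move behind the star-flip matchings of the coefficientwise point row; it is not injective by itself.) [this work] -/
theorem lobeFlip_cross_to_conc (s I₀ M : Finset ι) (Z : Set V) (u w : V)
    (hI₀ : ∀ i, i ∈ I₀ ↔ ∀ y ∈ ends i, y ∈ openCluster (ends '' (↑(sᶜ) : Set ι)) x ∧ y ∉ openCluster (ends '' (↑s : Set ι)) x)
    (hM : ∀ i, i ∈ M ↔ ∃ v, v ∈ openCluster (ends '' (↑I₀ : Set ι)) w ∧ v ∈ ends i)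
    (hZ : ∀ z ∈ Z, z ∉ openCluster (ends '' (↑s : Set ι)) x ∧ z ∉ openCluster (ends '' (↑(sᶜ) : Set ι)) x)
    (huK : u ∈ openCluster (ends '' (↑s : Set ι)) x) (huL : u ∉ openCluster (ends '' (↑(sᶜ) : Set ι)) x)
    (hwL : w ∈ openCluster (ends '' (↑(sᶜ) : Set ι)) x) (hwK : w ∉ openCluster (ends '' (↑s : Set ι)) x) :
    (∀ z ∈ Z, z ∉ openCluster (ends '' (↑(symmDiff s M) : Set ι)) x ∧ z ∉ openCluster (ends '' (↑((symmDiff s M)ᶜ) : Set ι)) x) ∧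
    (u ∈ openCluster (ends '' (↑(symmDiff s M) : Set ι)) x ∧ u ∉ openCluster (ends '' (↑((symmDiff s M)ᶜ) : Set ι)) x) ∧
    (w ∈ openCluster (ends '' (↑(symmDiff s M) : Set ι)) x ∧ w ∉ openCluster (ends '' (↑((symmDiff s M)ᶜ) : Set ι)) x) ∧
    openCluster (ends '' (↑(symmDiff s M) : Set ι)) x =
      openCluster (ends '' (↑s : Set ι)) x ∪ openCluster (ends '' (↑I₀ : Set ι)) w := by
  have hT := lobe_subset_island ends x s I₀ w hI₀ hwL hwK
  have hTc := lobe_closed ends x s I₀ w hI₀ hwL hwK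
  refine ⟨fun z hz => lobeFlip_wall ends x s M _ hT hTc hM (hZ z hz).1 (hZ z hz).2, ?_, ?_, lobeFlip_eq ends x s M _ hT hTc hM⟩
  · exact (lobeFlip_crossing ends x s M _ hT hTc hM huK huL (mem_openCluster_self _ w)).1
  · exact (lobeFlip_crossing ends x s M _ hT hTc hM huK huL (mem_openCluster_self _ w)).2

/-- **The exact blue cluster after a lobe flip**: `C_x((s ∆ M)ᶜ) = C_x(sᶜ ∖ M)` — the new blue cluster of `x` is the set of vertices blue-reachable from `x`
WITHOUT the edges at the lobe (sharpening `lobeFlip_compl_subset`: along a new-blue walk from `x` no flipped edge is ever used).  Consequently the lobe flip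
keeps the core `K ∩ K̄` and the zone iff every core vertex stays blue-reachable from `x` avoiding `T` (the attachment case); otherwise the core vertices cut
off by `T` become red-only. [this work] -/
theorem lobeFlip_compl_eq (s M : Finset ι) (T : Set V)
    (hT : ∀ v ∈ T, v ∈ openCluster (ends '' (↑(sᶜ) : Set ι)) x ∧ v ∉ openCluster (ends '' (↑s : Set ι)) x)
    (hTc : ∀ i, ∀ v ∈ T, v ∈ ends i → ∀ v' ∈ ends i,
      v' ∈ openCluster (ends '' (↑(sᶜ) : Set ι)) x → v' ∉ openCluster (ends '' (↑s : Set ι)) x → v' ∈ T)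
    (hM : ∀ i, i ∈ M ↔ ∃ v, v ∈ T ∧ v ∈ ends i) :
    openCluster (ends '' (↑((symmDiff s M)ᶜ) : Set ι)) x = openCluster (ends '' (↑(sᶜ \ M) : Set ι)) x := by
  set K : Set V := openCluster (ends '' (↑s : Set ι)) x with hK
  set L : Set V := openCluster (ends '' (↑(sᶜ) : Set ι)) x with hL
  apply Set.Subset.antisymm
  · -- walk transfer on `L \ T`: every new-blue edge met is an old blue edge missing `T`, i.e. an edge of `sᶜ \ M`
    have h : ∀ u ∈ (L \ T), ∀ w, (openGraph (ends '' (↑((symmDiff s M)ᶜ) : Set ι))).Adj u w →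
        (openGraph (ends '' (↑(sᶜ \ M) : Set ι))).Adj u w ∧ w ∈ (L \ T) := by
      intro u hu w hadj
      rw [openGraph_image_adj] at hadj
      obtain ⟨⟨i, hiPc, hi⟩, hne⟩ := hadj
      have hui : u ∈ ends i := by rw [hi]; exact Sym2.mem_mk_left u w
      have hwi : w ∈ ends i := by rw [hi]; exact Sym2.mem_mk_right u w
      have hiPc' : i ∉ symmDiff s M := Finset.mem_compl.mp hiPc
      rw [Finset.mem_symmDiff] at hiPc'
      by_cases his : i ∈ s
      · have hiM : i ∈ M := by by_contra hiM; exact hiPc' (Or.inl ⟨his, hiM⟩)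
        obtain ⟨v, hvT, hvi⟩ := (hM i).mp hiM
        exfalso
        rw [hi, Sym2.mem_iff] at hvi
        have hwT : w ∈ T := by
          rcases hvi with rfl | rfl
          · exact absurd hvT hu.2
          · exact hvT
        by_cases huK : u ∈ K
        · exact (hT w hwT).2 (mem_openCluster_of_mem_ends ends s x his huK hui hwi)
        · exact hu.2 (hTc i w hwT hwi u hui hu.1 huK)
      · have hiM : i ∉ M := by intro hiM; exact hiPc' (Or.inr ⟨hiM, his⟩)
        have hisc : i ∈ sᶜ := Finset.mem_compl.mpr his
        have hwL : w ∈ L := mem_openCluster_of_mem_ends ends sᶜ x hisc hu.1 hui hwi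
        have hwT : w ∉ T := fun hwT => hiM ((hM i).mpr ⟨w, hwT, hwi⟩)
        refine ⟨?_, hwL, hwT⟩
        rw [openGraph_image_adj]
        exact ⟨⟨i, Finset.mem_sdiff.mpr ⟨hisc, hiM⟩, hi⟩, hne⟩
    intro y hy
    obtain ⟨p⟩ := hy
    have hxT : x ∉ T := fun hxT => (hT x hxT).2 (mem_openCluster_self _ x)
    have hx : x ∈ L \ T := ⟨mem_openCluster_self _ x, hxT⟩
    exact ((reachable_transfer (L \ T) h p) hx).1
  · -- `sᶜ \ M ⊆ (s ∆ M)ᶜ`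
    apply openCluster_image_mono
    intro i hi
    rw [Finset.mem_sdiff] at hi
    rw [Finset.mem_compl, Finset.mem_symmDiff]
    rintro (⟨his, _⟩ | ⟨hiM, _⟩)
    · exact (Finset.mem_compl.mp hi.1) his
    · exact hi.2 hiM

end Coefficientwise

end Summit.CriticalPhenomena.PercolationContinuityZ3.Theorems
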